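import Summits.ResolutionOfSingularities.ResolutionOfSingularities.Theorems.MarkedTransferCampaignW46ThreefoldsPadded
import Literature.AlgebraicGeometry.Resolution.DivisorialPartLemmas
import Mathlib.Data.Multiset.DershowitzManna
import HarnessLib

/-!
# [OURS · L1 W4.6 rung (ii)] OUR MEASURE v2 — codimensions of the components of the terminal plat, compared in the
# Dershowitz–Manna order (definitions + the one-step inequality), for the component-wise reduction from the MONOTONE
# off-centre shape

Cell res-hironaka, LADDER-RESOLUTION rung L (D-0089), slot W4.6, rung (ii); seat res-L1-s46-pv-3 (gen 2). Host route
MarkedTransfer, host item `HypersurfaceOrderReductionDimLeThree` (stmt-16156); `--kind definition --supports` it (two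
bookkeeping definitions `codimSet`, `compMeasure` + kernel lemmas).

HONEST FRAMING. Everything below is OURS and classical (topology of Noetherian sober spaces, blow-ups as isomorphisms
off the centre, the Dershowitz–Manna multiset order); NOTHING here is a statement of H. Hironaka's manuscript
(2017-03-23, [Hironaka2017]) and nothing asserts that any statement of it holds. AI review is weaker than expert review.

## Why a second measure

The g0 component-wise reduction (`…ThreefoldsComponents`, measure = (padded top string, NUMBER of irreducible
components of `∇(E_k)`), de Jong 4.27 count) needs, when the top string stalls, the EQUALITY `∇(E′) = ∇′` (strict
transform of `∇(E)`), which in turn needs EQUALITY of the `Inv`-strings off the centre (`OffCentreLocal` /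
`OffCentreLocalPad` — the shapes OURS-DESK #38 found to force `m′ = m`). Under the substantively weaker MONOTONE shape
`OffCentreMonotone` («nothing gets worse off the centre», Threefolds.lean v4) one only gets the INCLUSION `∇(E′) ⊆ ∇′`,
and the number of components is not monotone under inclusion. THIS module supplies a measure that IS: to a closed set
`S` in a scheme of dimension `≤ d` attach the multiset `compMeasure d S` of the numbers `d − codim C` over the irreducible
components `C` of `S` (`codim C` = the codimension `coheight` of the generic point, written point-free as
`codimSet C = ⨅_{x ∈ C} coheight x`). ONE-STEP INEQUALITY (`compMeasure_lt_of_subset_strictTransformSet`): if `π : X′ → X`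
is an isomorphism off the component `D` of the closed set `S` and the closed `T ⊆ X′` lies in the strict transform
`⋃_{C ≠ D} C̃` of `S`, then `compMeasure d T <_DM compMeasure d S` in the Dershowitz–Manna order (Mathlib
`Multiset.IsDershowitzMannaLT`, well-founded over `ℕ`): the entry of `D` disappears; a component `C ≠ D` whose strict
transform `C̃` is still a component of `T` keeps its entry (`codim C̃ = codim C`: the generic point of `C̃` lies over the
generic point of `C`, where `π` is a local homeomorphism); every other component of `T` is a PROPER closed irreducible
subset of some `C̃`, of strictly larger codimension (`eq_of_specializes_of_coheight_le`, finiteness from `dim ≤ d`), i.e.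
strictly smaller entry. The companion module `MarkedTransferCampaignW46ThreefoldsMonotone` runs the component-wise
reduction on (padded top string, `compMeasure`) — using the regime's DIMENSION BOUND, which is where rung (ii)
(`dim ≤ 3`) enters the termination argument itself.

References: Threefolds.lean v4 (p481395), `…ThreefoldsPadded` (p481859); tree `Resolution.componentsIn` /
`strictTransformSet` (de Jong 1996, 2.18/4.27 [deJong1996]; Görtz–Wedhorn (13.19) [GortzWedhorn2020]),
`IsBlowup.isIso_morphismRestrict`, `eq_of_specializes_of_coheight_le`; N. Dershowitz, Z. Manna, *Proving termination with
multiset orderings*, CACM 22 (1979) — through Mathlib `Multiset.IsDershowitzMannaLT` [DershowitzManna1979].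
H. Hironaka, ms. 2017-03-23, §16.3 p.87 l.14–24 — scope only, under adjudication, not cited as fact. [Hironaka2017]
-/

noncomputable section

set_option linter.dupNamespace false -- mandated namespace of this single-conjunct summit

open CategoryTheory AlgebraicGeometry TopologicalSpace Topology

namespace Summit.ResolutionOfSingularities.ResolutionOfSingularities.Theorems

namespace CampaignW46

open Literature.AlgebraicGeometry.Resolution

universe u

/-! ## Codimension of a subset, point-free; the component measure -/

/-- [OURS] The CODIMENSION VALUE of a subset `C` of a scheme `X`: the infimum of the codimensions `coheight x` (length of
chains of generizations, = `dim 𝒪_{X,x}`) of its points — for an irreducible closed `C` this is the codimension of its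
generic point (`codimSet_eq_coheight`). Bookkeeping definition for the measure below; NOT a statement of the manuscript.
[folklore] -/
def codimSet {X : Scheme.{u}} (C : Set X) : ℕ∞ :=
  ⨅ x ∈ C, Order.coheight x

/-- [OURS] THE COMPONENT MEASURE of a subset `S` of a scheme relative to a dimension bound `d`: the multiset of the
numbers `d − codim C` over the irreducible components `C` of `S` (`Resolution.componentsIn`; the empty multiset if there
are infinitely many). Compared in the Dershowitz–Manna order. Bookkeeping definition; NOT a statement of the manuscript.
[folklore] -/
def compMeasure {X : Scheme.{u}} (d : ℕ) (S : Set X) : Multiset ℕ := by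
  classical
  exact if h : (componentsIn S).Finite then h.toFinset.val.map (fun C => d - (codimSet C).toNat) else 0

/-- Unfolding `compMeasure` at a set with finitely many components. [folklore] -/
theorem compMeasure_eq {X : Scheme.{u}} (d : ℕ) {S : Set X} (h : (componentsIn S).Finite) :
    compMeasure d S = h.toFinset.val.map (fun C => d - (codimSet C).toNat) := by
  classical
  unfold compMeasure
  simp only [dif_pos h]

/-! ## Codimension of an irreducible closed set through its generic point -/

section Codim

variable {X : Scheme.{u}}

/-- The codimension value of a set with generic point `ζ` is `coheight ζ` (every point of the set is a specialisation of
`ζ`, and `coheight` is antitone). [folklore] -/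
theorem codimSet_eq_coheight {C : Set X} {ζ : X} (h : IsGenericPoint ζ C) : codimSet C = Order.coheight ζ := by
  apply le_antisymm
  · exact iInf₂_le ζ h.mem
  · refine le_iInf₂ fun x hx => ?_
    exact Order.coheight_anti (Scheme.le_iff_specializes.mpr (h.specializes hx))

/-- The codimension value of a non-empty set in a scheme all of whose points have codimension `≤ d` is `≤ d`.
[folklore] -/
theorem codimSet_le_of_nonempty {C : Set X} (hC : C.Nonempty) {d : ℕ} (hd : ∀ x : X, Order.coheight x ≤ d) :
    codimSet C ≤ d := by
  obtain ⟨x, hx⟩ := hC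
  exact (iInf₂_le x hx).trans (hd x)

/-- **A proper irreducible closed subset has strictly larger codimension** (finite-dimensional case): for irreducible
closed `W ⊆ C`, `W ≠ C`, in a scheme whose points have codimension `≤ d`, `codimSet C < codimSet W` — the generic point
of `C` strictly generalises that of `W` (tree `eq_of_specializes_of_coheight_le`). [folklore] -/
theorem codimSet_lt_of_subset_of_ne {W C : Set X} (hW : IsIrreducible W) (hWc : IsClosed W) (hC : IsIrreducible C)
    (hCc : IsClosed C) (hWC : W ⊆ C) (hne : W ≠ C) {d : ℕ} (hd : ∀ x : X, Order.coheight x ≤ d) :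
    codimSet C < codimSet W := by
  obtain ⟨ζW, hζW⟩ := QuasiSober.sober hW hWc
  obtain ⟨ζC, hζC⟩ := QuasiSober.sober hC hCc
  rw [codimSet_eq_coheight hζW, codimSet_eq_coheight hζC]
  have hsp : ζC ⤳ ζW := hζC.specializes (hWC hζW.mem)
  by_contra hle
  rw [not_lt] at hle
  have hfin : Order.coheight ζW ≠ ⊤ := ne_top_of_le_ne_top (ENat.coe_ne_top d) (hd ζW)
  have heq : ζC = ζW := eq_of_specializes_of_coheight_le hsp hfin hle
  apply hne
  rw [← hζW.def, ← hζC.def, heq]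

end Codim

/-! ## A morphism which is an isomorphism off a closed set: codimensions and specialisations off that set -/

section IsoOff

variable {X' X : Scheme.{u}} (π : X' ⟶ X) {D : Set X} (hDc : IsClosed D)

/-- Off the closed set `D` over which `π` is an isomorphism, `π` preserves codimension: `coheight x′ = coheight (π x′)`
for `π x′ ∉ D` (open immersions preserve `coheight`, Mathlib `coheight_eq_of_isOpenImmersion`). [folklore] -/
theorem coheight_eq_of_apply_not_mem [IsIso (π ∣_ ⟨Dᶜ, hDc.isOpen_compl⟩)] {x' : X'} (hx : π x' ∉ D) :
    Order.coheight x' = Order.coheight (π x') := by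
  set U : X.Opens := ⟨Dᶜ, hDc.isOpen_compl⟩ with hU
  have hx' : x' ∈ π ⁻¹ᵁ U := hx
  let y : (π ⁻¹ᵁ U).toScheme := ⟨x', hx'⟩
  have h1 : Order.coheight ((π ⁻¹ᵁ U).ι y) = Order.coheight y := coheight_eq_of_isOpenImmersion (π ⁻¹ᵁ U).ι
  have h2 : Order.coheight ((π ∣_ U) y) = Order.coheight y := coheight_eq_of_isOpenImmersion (π ∣_ U)
  have h3 : Order.coheight (U.ι ((π ∣_ U) y)) = Order.coheight ((π ∣_ U) y) :=
    coheight_eq_of_isOpenImmersion U.ι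
  have h4 : U.ι ((π ∣_ U) y) = π ((π ⁻¹ᵁ U).ι y) := by
    rw [← Scheme.Hom.comp_apply, ← Scheme.Hom.comp_apply, morphismRestrict_ι]
  have h0 : (π ⁻¹ᵁ U).ι y = x' := rfl
  rw [← h0, h1, ← h2, ← h3, h4]

/-- Off `D`, specialisations downstairs lift: if `π x′, π y′ ∉ D` and `π x′ ⤳ π y′` then `x′ ⤳ y′` (`π` restricts to a
homeomorphism `π⁻¹(X ∖ D) ≅ X ∖ D`, and specialisation is intrinsic to open subspaces). [folklore] -/
theorem specializes_of_apply_specializes [IsIso (π ∣_ ⟨Dᶜ, hDc.isOpen_compl⟩)] {x' y' : X'} (hx : π x' ∉ D)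
    (hy : π y' ∉ D) (h : π x' ⤳ π y') : x' ⤳ y' := by
  set U : X.Opens := ⟨Dᶜ, hDc.isOpen_compl⟩ with hU
  let a : (π ⁻¹ᵁ U).toScheme := ⟨x', (hx : x' ∈ π ⁻¹ᵁ U)⟩
  let b : (π ⁻¹ᵁ U).toScheme := ⟨y', (hy : y' ∈ π ⁻¹ᵁ U)⟩
  let φ := (π ∣_ U).homeomorph
  have hι : ∀ c : (π ⁻¹ᵁ U).toScheme, U.ι (φ c) = π ((π ⁻¹ᵁ U).ι c) := fun c => by
    rw [Scheme.Hom.homeomorph_apply, ← Scheme.Hom.comp_apply, ← Scheme.Hom.comp_apply, morphismRestrict_ι]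
  have hab : φ a ⤳ φ b := by
    rw [← U.ι.isOpenEmbedding.isInducing.specializes_iff, hι a, hι b]
    exact h
  have hab' : a ⤳ b := by
    have := hab.map φ.symm.continuous
    rwa [φ.symm_apply_apply, φ.symm_apply_apply] at this
  exact hab'.map (π ⁻¹ᵁ U).ι.continuous

/-- Off `D`, every point downstairs has a preimage (tree `exists_apply_eq_of_isIso_morphismRestrict`, restated with the
centre as a closed SET). [folklore] -/
theorem exists_apply_eq_of_not_mem [IsIso (π ∣_ ⟨Dᶜ, hDc.isOpen_compl⟩)] {x : X} (hx : x ∉ D) :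
    ∃ x' : X', π x' = x :=
  exists_apply_eq_of_isIso_morphismRestrict π ⟨Dᶜ, hDc.isOpen_compl⟩ hx

/-- **The strict transform of an irreducible closed `C ⊄ D` has a generic point over the generic point of `C`**, for
`π` an isomorphism off the closed `D`: if `ζ` is a generic point of `C`, `ζ ∉ D`, and `π ζ′ = ζ`, then `ζ′` is a generic
point of `strictTransformSet π D C = closure (π⁻¹(C ∖ D))`. [folklore] -/
theorem isGenericPoint_strictTransformSet [IsIso (π ∣_ ⟨Dᶜ, hDc.isOpen_compl⟩)] {C : Set X} {ζ : X}
    (hζ : IsGenericPoint ζ C) (hζD : ζ ∉ D) {ζ' : X'} (hζ' : π ζ' = ζ) :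
    IsGenericPoint ζ' (strictTransformSet π D C) := by
  have hmem : ζ' ∈ π ⁻¹' (C \ D) := by
    rw [Set.mem_preimage, hζ']
    exact ⟨hζ.mem, hζD⟩
  apply le_antisymm
  · -- `closure {ζ′} ⊆ closure (π⁻¹(C ∖ D))`
    exact closure_mono (Set.singleton_subset_iff.mpr hmem)
  · -- `π⁻¹(C ∖ D) ⊆ closure {ζ′}`: specialisations of `ζ` off `D` lift to specialisations of `ζ′`
    refine closure_minimal (fun x' hx' => ?_) isClosed_closure
    rw [Set.mem_preimage] at hx'
    have hsp : π ζ' ⤳ π x' := by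
      rw [hζ']
      exact hζ.specializes hx'.1
    have hζD' : π ζ' ∉ D := by rwa [hζ']
    exact specializes_iff_mem_closure.mp (specializes_of_apply_specializes π hDc hζD' hx'.2 hsp)

/-- **Strict transforms keep the codimension**: for `π` an isomorphism off the closed `D` and an irreducible closed `C`
with `C ⊄ D` (so its generic point is off `D`), `codimSet (strictTransformSet π D C) = codimSet C`. [folklore] -/
theorem codimSet_strictTransformSet [IsIso (π ∣_ ⟨Dᶜ, hDc.isOpen_compl⟩)] {C : Set X} (hC : IsIrreducible C)
    (hCc : IsClosed C) (hCD : ¬ C ⊆ D) : codimSet (strictTransformSet π D C) = codimSet C := by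
  obtain ⟨ζ, hζ⟩ := QuasiSober.sober hC hCc
  have hζD : ζ ∉ D := fun h => hCD (by
    rw [← hζ.def]
    exact closure_minimal (Set.singleton_subset_iff.mpr h) hDc)
  obtain ⟨ζ', hζ'⟩ := exists_apply_eq_of_not_mem π hDc hζD
  rw [codimSet_eq_coheight (isGenericPoint_strictTransformSet π hDc hζ hζD hζ'), codimSet_eq_coheight hζ,
    coheight_eq_of_apply_not_mem π hDc (by rw [hζ']; exact hζD), hζ']

end IsoOff

/-! ## The one-step inequality in the Dershowitz–Manna order -/

section Inequality

/-- Arithmetic of the entries: a strictly larger finite codimension gives a strictly smaller entry `d − codim`.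
[folklore] -/
theorem sub_toNat_lt_of_lt {c c' : ℕ∞} {d : ℕ} (hlt : c < c') (hle : c' ≤ d) : d - c'.toNat < d - c.toNat := by
  have hc' : c' ≠ ⊤ := ne_top_of_le_ne_top (ENat.coe_ne_top d) hle
  have hc : c ≠ ⊤ := ne_top_of_lt hlt
  obtain ⟨a, rfl⟩ := ENat.ne_top_iff_exists.mp hc'
  obtain ⟨b, rfl⟩ := ENat.ne_top_iff_exists.mp hc
  simp only [ENat.toNat_coe]
  have h1 : b < a := by exact_mod_cast hlt
  have h2 : a ≤ d := by exact_mod_cast hle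
  omega

variable {X' X : Scheme.{u}} (π : X' ⟶ X) {D : Set X} (hDc : IsClosed D)

/-- An irreducible subset of the strict transform of `S` (finitely many components) lies in the strict transform of one
component `C ≠ D` of `S`. [folklore] -/
theorem exists_subset_strictTransformSet_of_isIrreducible {S : Set X} (hfinS : (componentsIn S).Finite)
    {W : Set X'} (hW : IsIrreducible W) (hWS : W ⊆ strictTransformSet π D S) :
    ∃ C ∈ componentsIn S, C ≠ D ∧ W ⊆ strictTransformSet π D C := by
  classical
  let F : Finset (Set X') := (hfinS.toFinset.erase D).image (strictTransformSet π D)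
  have hcl : ∀ z ∈ F, IsClosed z := by
    intro z hz
    obtain ⟨C, -, rfl⟩ := Finset.mem_image.mp hz
    exact strictTransformSet.isClosed π D C
  have hsub : W ⊆ ⋃₀ (F : Set (Set X')) := by
    intro x hx
    have hx' := hWS hx
    rw [strictTransformSet_eq_biUnion_componentsIn π D hfinS] at hx'
    simp only [Set.mem_iUnion, Set.mem_sdiff, Set.mem_singleton_iff, exists_prop] at hx'
    obtain ⟨C, ⟨hC, hCD⟩, hxC⟩ := hx'
    refine Set.mem_sUnion_of_mem hxC ?_
    rw [Finset.mem_coe, Finset.mem_image]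
    exact ⟨C, Finset.mem_erase.mpr ⟨hCD, (Set.Finite.mem_toFinset _).mpr hC⟩, rfl⟩
  obtain ⟨z, hz, hWz⟩ := isIrreducible_iff_sUnion_isClosed.mp hW F hcl hsub
  obtain ⟨C, hC, rfl⟩ := Finset.mem_image.mp hz
  rw [Finset.mem_erase, Set.Finite.mem_toFinset] at hC
  exact ⟨C, hC.2, hC.1, hWz⟩

/-- **THE ONE-STEP INEQUALITY.** Let `S ⊆ X` be closed with finitely many irreducible components, `D` one of them,
`π : X′ → X` an isomorphism off `D`, and `T ⊆ X′` closed with finitely many components, contained in the strict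
transform of `S` along `D`; assume all points of `X′` have codimension `≤ d` (`dim X′ ≤ d`). Then
`compMeasure d T <_DM compMeasure d S` (Dershowitz–Manna): split the components `C ≠ D` of `S` into those whose
strict transform `C̃` is a component of `T` (entries kept, `codimSet_strictTransformSet`) and the rest (entries removed,
together with the entry of `D`); every remaining component of `T` is a proper irreducible closed subset of some removed
`C̃`, with strictly smaller entry (`codimSet_lt_of_subset_of_ne`). [folklore] -/
theorem isDershowitzMannaLT_compMeasure [IsIso (π ∣_ ⟨Dᶜ, hDc.isOpen_compl⟩)] {S : Set X} (hS : IsClosed S)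
    (hfinS : (componentsIn S).Finite) (hD : D ∈ componentsIn S) {T : Set X'} (hT : IsClosed T)
    (hfinT : (componentsIn T).Finite) (hTS : T ⊆ strictTransformSet π D S) {d : ℕ}
    (hdX' : ∀ x' : X', Order.coheight x' ≤ d) :
    Multiset.IsDershowitzMannaLT (compMeasure d T) (compMeasure d S) := by
  classical
  -- notation
  let st : Set X → Set X' := strictTransformSet π D
  let v : Set X → ℕ := fun C => d - (codimSet C).toNat
  let v' : Set X' → ℕ := fun W => d - (codimSet W).toNat
  let FS : Finset (Set X) := hfinS.toFinset
  let FT : Finset (Set X') := hfinT.toFinset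
  let KEPT : Finset (Set X) := (FS.erase D).filter fun C => st C ∈ componentsIn T
  let REPL : Finset (Set X) := (FS.erase D).filter fun C => st C ∉ componentsIn T
  -- basic facts about the components `C ≠ D` of `S`
  have hmemFS : ∀ {C}, C ∈ FS.erase D ↔ C ≠ D ∧ C ∈ componentsIn S := fun {C} => by
    rw [Finset.mem_erase, Set.Finite.mem_toFinset]
  have hnotsub : ∀ {C}, C ∈ componentsIn S → C ≠ D → ¬ C ⊆ D := fun hC hne =>
    not_subset_of_mem_componentsIn_of_ne hD hC hne
  have hv : ∀ C ∈ FS.erase D, v' (st C) = v C := by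
    intro C hC
    obtain ⟨hne, hC⟩ := hmemFS.mp hC
    change d - (codimSet (strictTransformSet π D C)).toNat = d - (codimSet C).toNat
    rw [codimSet_strictTransformSet π hDc (componentsIn.isIrreducible hC) (componentsIn.isClosed hS hC)
      (hnotsub hC hne)]
  have hinj : Set.InjOn st ↑KEPT := by
    intro C₁ hC₁ C₂ hC₂ h
    rw [Finset.mem_coe, Finset.mem_filter] at hC₁ hC₂
    obtain ⟨hne₁, hC₁'⟩ := hmemFS.mp hC₁.1
    obtain ⟨-, hC₂'⟩ := hmemFS.mp hC₂.1
    exact eq_of_strictTransformSet_subset π hS hDc hD hC₁' hC₂' hne₁ h.le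
  -- the three multisets
  refine ⟨KEPT.val.map v, (FT.filter fun W => W ∉ KEPT.image st).val.map v',
    v D ::ₘ REPL.val.map v, Multiset.cons_ne_zero, ?_, ?_, ?_⟩
  · -- `M = X + Y`
    have hsub : KEPT.image st ⊆ FT := by
      intro W hW
      obtain ⟨C, hC, rfl⟩ := Finset.mem_image.mp hW
      exact (Set.Finite.mem_toFinset _).mpr (Finset.mem_filter.mp hC).2
    have hsplit : FT.val = (KEPT.image st).val + (FT.filter fun W => W ∉ KEPT.image st).val := by
      have h1 : (FT.filter fun W => W ∈ KEPT.image st) = KEPT.image st := by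
        ext W
        simp only [Finset.mem_filter, and_iff_right_iff_imp]
        exact fun hW => hsub hW
      have h2 := (Multiset.filter_add_not (fun W => W ∈ KEPT.image st) FT.val).symm
      rw [← Finset.filter_val, ← Finset.filter_val, h1] at h2
      exact h2
    rw [compMeasure_eq d hfinT]
    change FT.val.map v' = _
    rw [hsplit, Multiset.map_add, Finset.image_val_of_injOn hinj, Multiset.map_map]
    congr 1
    refine Multiset.map_congr rfl fun C hC => ?_
    exact hv C (Finset.mem_filter.mp hC).1
  · -- `N = X + Z`
    have hDFS : D ∈ FS.val := (Set.Finite.mem_toFinset _).mpr hD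
    rw [compMeasure_eq d hfinS]
    change FS.val.map v = _
    rw [← Multiset.cons_erase hDFS, ← Finset.erase_val, Multiset.map_cons]
    have hsplit : (FS.erase D).val = KEPT.val + REPL.val := by
      rw [Finset.filter_val, Finset.filter_val]
      exact (Multiset.filter_add_not (fun C => st C ∈ componentsIn T) (FS.erase D).val).symm
    rw [hsplit, Multiset.map_add, Multiset.add_cons]
  · -- every entry of `Y` is below an entry of `Z`
    intro y hy
    obtain ⟨W, hW, rfl⟩ := Multiset.mem_map.mp hy
    rw [Finset.mem_val, Finset.mem_filter, Set.Finite.mem_toFinset] at hW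
    obtain ⟨hWT, hWimg⟩ := hW
    have hWirr : IsIrreducible W := componentsIn.isIrreducible hWT
    obtain ⟨C, hC, hCD, hWC⟩ :=
      exists_subset_strictTransformSet_of_isIrreducible π hfinS hWirr ((componentsIn.subset hWT).trans hTS)
    -- the strict transform of `C` is not a component of `T` (else `W` would be it)
    have hWne : W ≠ st C := by
      rintro rfl
      apply hWimg
      refine Finset.mem_image.mpr ⟨C, Finset.mem_filter.mpr ⟨hmemFS.mpr ⟨hCD, hC⟩, hWT⟩, rfl⟩
    have hstC : st C ∉ componentsIn T := fun hmem =>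
      not_subset_of_mem_componentsIn_of_ne hmem hWT hWne hWC
    refine ⟨v C, Multiset.mem_cons_of_mem (Multiset.mem_map_of_mem v ?_), ?_⟩
    · rw [Finset.mem_val, Finset.mem_filter]
      exact ⟨hmemFS.mpr ⟨hCD, hC⟩, hstC⟩
    · -- `v' W < v C = v' (st C)`
      have hlt : codimSet (st C) < codimSet W :=
        codimSet_lt_of_subset_of_ne hWirr (componentsIn.isClosed hT hWT)
          (isIrreducible_strictTransformSet π hDc hD hC hCD) (strictTransformSet.isClosed π D C) hWC hWne hdX'
      rw [← hv C (hmemFS.mpr ⟨hCD, hC⟩)]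
      exact sub_toNat_lt_of_lt hlt (codimSet_le_of_nonempty (componentsIn.nonempty hWT) hdX')

end Inequality

end CampaignW46

end Summit.ResolutionOfSingularities.ResolutionOfSingularities.Theorems

end
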